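import Summits.QuantumFields.YangMills.Theorems.AlphaInputsT3ACv3SectionChart
import HarnessLib

/-!
# `AlphaInputsT3ACv3TubeGraft` — START v3.1 for the (FL) `hLift` binder, row (S5), part 2: **GRAFTING A MODEL TUBE INTO THE SECTION ALONG AN INTERIOR EDGE** — the anisotropic chart box
# (transverse half-width `Rt`, longitudinal half-height `⌊L^k/2⌋` = the whole cell) at the corner site of a coarse plaquette `(y; μ, ν)`; the section read there IS the model section on
# every bond with both endpoints in the box (`pullB_iterSec_eq_modelSec₂`, the two-radii form of part 1); the grafted field `graft c μ ν Rt hl M W` (model field `M` on the charted box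
# bonds, `W` elsewhere); its values (`graft_apply_boxSite`, `graft_apply_of_not`) and ★★ its plaquettes inside the box = the model plaquettes (`plaqHol_graft_boxSite`), hence for
# `M = tubeU … t` EXACTLY `G⁻¹·expSU(curlB t·F′)·G` (`dist1_plaqHol_graft_tubeU_le`) — lane `pub-balaban3d` ∕ cell `ym3-torus`, seat `ym-ust-19936-w1` (g2, LEAD)

WHY (memo v3 §3 (T) + bus START v3.1 02:53Z: one-quadrant tubes run the WHOLE interior edge; the ball of an interior vertex overrides them near the vertex; at a boundary endpoint they
end for free).  Part 1 (`…v3SectionChart`) identified the section with the model section on an ISOTROPIC box strictly inside the cell; the tube needs the whole cell height, where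
the longitudinal top slice is still fine for TRANSVERSE bonds and only the exiting longitudinal bond must be excluded — hence the two-radii box with «both endpoints in the box».
WHAT IS HERE: §1 `InTube μ ν Rt hl u` (`|u_i| ≤ Rt` transversally, `≤ hl` longitudinally) and the two-radii chart lemmas `isLast_boxSite_cornerSite_iff₂`,
`coarsen_boxSite_cornerSite_apply₂`, ★ `pullB_iterSec_eq_modelSec₂`; §2 the graft (one `def`), `graft_apply_boxSite` (injectivity of the chart on the box, `boxSite_injOn`),
`graft_apply_of_not`, ★★ `plaqHol_graft_boxSite`, `dist1_plaqHol_graft_tubeU_le`, `plaqHol_graft_tubeU_eq_one`; §3 `graft_tubeU_eq_iterSec_of_eq_stringInd` (off the profile the graft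
IS the section, by `tubeU_eq_modelSec_of_eq` + §1).
HONEST FRAMING.  Lattice bookkeeping over parts (S1)–(S2) and part 1; the profile, the vertex balls, the region bookkeeping and the defect are NOT here; (FL)∕`hLift` NOT proved;
count-neutral helper toward R3 2′ (items 19936∕19935); registry untouched; nothing about d = 4, the continuum, or a mass gap; YM₃ on T³ is rung R3, not Clay.

References: T. Bałaban, Commun. Math. Phys. 102 (1985) 277–309 [Balaban1985Variational] ((11)–(14) pp.279–280); Commun. Math. Phys. 98 (1985) 17–51 [Balaban1985Averaging]
((8)–(9), (12) p.19); Commun. Math. Phys. 109 (1987) 249–301 [Balaban1987RG1] ((0.1), (0.3) pp.251–252).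
-/

set_option autoImplicit false

noncomputable section

open scoped Matrix.Norms.L2Operator

namespace Summit.QuantumFields.YangMills.Theorems.TubeStart

open Literature.MathematicalPhysics.QuantumFieldTheory.Balaban1983to89
open Literature.MathematicalPhysics.QuantumFieldTheory.Balaban1983to89.T4AdjointCovarianceUnitary (lieSU expSU)
open Literature.MathematicalPhysics.QuantumFieldTheory.Balaban1983to89.BlockAveragingSectionAction (iterSec)
open Summit.QuantumFields.Balaban3D.Carriers
open Summit.QuantumFields.YangMills.Theorems.ModelBox

/-! ## §1 The two-radii chart box at the corner of a coarse plaquette -/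

section TwoRadii

variable {P : Params}

/-- **THE TUBE BOX**: `|u_i| ≤ Rt` in the two transverse directions `μ, ν` and `|u_i| ≤ hl` in every other (longitudinal) direction. [folklore] -/
def InTube (μ ν : Fin P.d) (Rt hl : ℕ) (u : Fin P.d → ℤ) : Prop :=
  ∀ i, |u i| ≤ ((if i = μ ∨ i = ν then Rt else hl : ℕ) : ℤ)

/-- The tube box lies in the isotropic box of the larger radius. [folklore] -/
theorem InTube.inBox {μ ν : Fin P.d} {Rt hl : ℕ} {u : Fin P.d → ℤ} (h : InTube μ ν Rt hl u) : InBox (max Rt hl) u := by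
  intro i
  refine (h i).trans ?_
  split_ifs
  · exact_mod_cast le_max_left _ _
  · exact_mod_cast le_max_right _ _

/-- Transverse bound. [folklore] -/
theorem InTube.abs_le_of_mem {μ ν : Fin P.d} {Rt hl : ℕ} {u : Fin P.d → ℤ} (h : InTube μ ν Rt hl u) {i : Fin P.d} (hi : i = μ ∨ i = ν) : |u i| ≤ (Rt : ℤ) := by
  have := h i; rwa [if_pos hi] at this

/-- Longitudinal bound. [folklore] -/
theorem InTube.abs_le_of_not_mem {μ ν : Fin P.d} {Rt hl : ℕ} {u : Fin P.d → ℤ} (h : InTube μ ν Rt hl u) {i : Fin P.d} (hi : ¬ (i = μ ∨ i = ν)) : |u i| ≤ (hl : ℤ) := by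
  have := h i; rwa [if_neg hi] at this

variable {k : ℕ} (hk : k ≤ P.m + P.K) (y : Site P k) (μ ν : Fin P.d) {Rt : ℕ} {u : Fin P.d → ℤ} (hu : InTube μ ν Rt (P.L ^ k / 2) u)
  (hRt : Rt + 2 ≤ P.L ^ k)
include hk hu hRt

omit hk in
/-- Transverse coordinate, non-positive offset (two-radii box). [cite: Balaban1987RG1, (0.3) p.252] -/
theorem corner_transverse_le₂ {i : Fin P.d} (hi : i = μ ∨ i = ν) (hui : u i ≤ 0) :
    ∃ s : ℕ, (s : ℤ) = ((2 * (P.L ^ k / 2) : ℕ) : ℤ) + u i ∧ s < P.L ^ k ∧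
      boxSite (cornerSite k y μ ν) u i = (((y i).val * P.L ^ k + s : ℕ) : ZMod (P.sitesPerDir 0)) := by
  obtain ⟨h1, h2⟩ := abs_le.mp (hu.abs_le_of_mem hi)
  have hodd := pow_eq_two_mul_half_add_one (P := P) k
  obtain ⟨s, hs⟩ := Int.eq_ofNat_of_zero_le (show (0 : ℤ) ≤ ((2 * (P.L ^ k / 2) : ℕ) : ℤ) + u i by omega)
  refine ⟨s, hs.symm, by omega, ?_⟩
  show cornerSite k y μ ν i + ((u i : ℤ) : ZMod (P.sitesPerDir 0)) = _
  rw [cornerSite_apply_of_mem k y hi]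
  exact natCast_add_intCast_eq (by push_cast [Nat.cast_add] at hs ⊢; omega)

omit hk in
/-- Transverse coordinate, positive offset (two-radii box). [cite: Balaban1987RG1, (0.3) p.252] -/
theorem corner_transverse_pos₂ {i : Fin P.d} (hi : i = μ ∨ i = ν) (hui : 1 ≤ u i) :
    ∃ s : ℕ, (s : ℤ) = u i - 1 ∧ s + 1 < P.L ^ k ∧
      boxSite (cornerSite k y μ ν) u i = ((((y i).val + 1) * P.L ^ k + s : ℕ) : ZMod (P.sitesPerDir 0)) := by
  obtain ⟨h1, h2⟩ := abs_le.mp (hu.abs_le_of_mem hi)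
  have hodd := pow_eq_two_mul_half_add_one (P := P) k
  obtain ⟨s, hs⟩ := Int.eq_ofNat_of_zero_le (show (0 : ℤ) ≤ u i - 1 by omega)
  refine ⟨s, hs.symm, by omega, ?_⟩
  show cornerSite k y μ ν i + ((u i : ℤ) : ZMod (P.sitesPerDir 0)) = _
  rw [cornerSite_apply_of_mem k y hi]
  refine natCast_add_intCast_eq ?_
  have e1 : (((y i).val * P.L ^ k + 2 * (P.L ^ k / 2) : ℕ) : ℤ) = ((y i).val * P.L ^ k : ℕ) + ((2 * (P.L ^ k / 2) : ℕ) : ℤ) := by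
    push_cast [Nat.cast_add]; ring
  have e2 : ((((y i).val + 1) * P.L ^ k + s : ℕ) : ℤ) = ((y i).val * P.L ^ k : ℕ) + ((P.L ^ k : ℕ) : ℤ) + (s : ℤ) := by
    push_cast [Nat.cast_add, Nat.cast_mul]; ring
  rw [e1, e2]
  omega

omit hk hRt in
/-- Longitudinal coordinate (two-radii box): position `⌊L^k/2⌋ + u_i ∈ [0, L^k − 1]` in cell `y_i`. [cite: Balaban1987RG1, (0.3) p.252] -/
theorem corner_longitudinal₂ {i : Fin P.d} (hi : ¬ (i = μ ∨ i = ν)) :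
    ∃ s : ℕ, (s : ℤ) = ((P.L ^ k / 2 : ℕ) : ℤ) + u i ∧ s < P.L ^ k ∧
      boxSite (cornerSite k y μ ν) u i = (((y i).val * P.L ^ k + s : ℕ) : ZMod (P.sitesPerDir 0)) := by
  obtain ⟨h1, h2⟩ := abs_le.mp (hu.abs_le_of_not_mem hi)
  have hodd := pow_eq_two_mul_half_add_one (P := P) k
  obtain ⟨s, hs⟩ := Int.eq_ofNat_of_zero_le (show (0 : ℤ) ≤ ((P.L ^ k / 2 : ℕ) : ℤ) + u i by omega)
  refine ⟨s, hs.symm, by omega, ?_⟩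
  show cornerSite k y μ ν i + ((u i : ℤ) : ZMod (P.sitesPerDir 0)) = _
  rw [cornerSite_apply_of_not_mem k y hi]
  refine natCast_add_intCast_eq ?_
  have e1 : (((y i).val * P.L ^ k + P.L ^ k / 2 : ℕ) : ℤ) = ((y i).val * P.L ^ k : ℕ) + ((P.L ^ k / 2 : ℕ) : ℤ) := by
    push_cast [Nat.cast_add]; ring
  have e2 : (((y i).val * P.L ^ k + s : ℕ) : ℤ) = ((y i).val * P.L ^ k : ℕ) + (s : ℤ) := by
    push_cast [Nat.cast_add]; ring
  rw [e1, e2]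
  omega

/-- **LAST SITES IN THE TUBE BOX**: `(c + u)_i` is last in its cell iff (`i` transverse and `u_i = 0`) or (`i` longitudinal and `u_i = ⌊L^k/2⌋`, the top slice). [cite: Balaban1987RG1, (0.3) p.252] -/
theorem isLast_boxSite_cornerSite_iff₂ (i : Fin P.d) :
    (boxSite (cornerSite k y μ ν) u i).val % P.L ^ k = P.L ^ k - 1 ↔
      ((i = μ ∨ i = ν) ∧ u i = 0) ∨ (¬ (i = μ ∨ i = ν) ∧ u i = (P.L ^ k / 2 : ℕ)) := by
  have hodd := pow_eq_two_mul_half_add_one (P := P) k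
  by_cases hi : i = μ ∨ i = ν
  · by_cases hui : u i ≤ 0
    · obtain ⟨s, hs, hsm, hx⟩ := corner_transverse_le₂ y μ ν hu hRt hi hui
      rw [(val_mod_div_of_eq_cast hk hsm hx).1]
      constructor
      · intro h; exact Or.inl ⟨hi, by omega⟩
      · rintro (⟨-, h0⟩ | ⟨h', -⟩)
        · omega
        · exact absurd hi h'
    · obtain ⟨s, hs, hsm, hx⟩ := corner_transverse_pos₂ y μ ν hu hRt hi (by omega)
      rw [(val_mod_div_of_eq_cast hk (by omega) hx).1]
      constructor
      · intro h; omega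
      · rintro (⟨-, h0⟩ | ⟨h', -⟩)
        · omega
        · exact absurd hi h'
  · obtain ⟨s, hs, hsm, hx⟩ := corner_longitudinal₂ y μ ν hu hi
    rw [(val_mod_div_of_eq_cast hk hsm hx).1]
    constructor
    · intro h; exact Or.inr ⟨hi, by omega⟩
    · rintro (⟨h', -⟩ | ⟨-, h0⟩)
      · exact absurd h' hi
      · omega

/-- **THE CELL OF A TUBE-BOX POINT**: `y`, moved by `e_i` exactly in the transverse directions with `u_i ≥ 1`. [cite: Balaban1987RG1, (0.3) p.252] -/
theorem coarsen_boxSite_cornerSite_apply₂ (i : Fin P.d) :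
    (coarsen k (boxSite (cornerSite k y μ ν) u)) i = if (i = μ ∨ i = ν) ∧ 1 ≤ u i then y i + 1 else y i := by
  by_cases hi : i = μ ∨ i = ν
  · by_cases hui : 1 ≤ u i
    · obtain ⟨s, hs, hsm, hx⟩ := corner_transverse_pos₂ y μ ν hu hRt hi hui
      rw [if_pos ⟨hi, hui⟩, coarsen_apply_of_eq_cast hk _ i (by omega) hx]
      push_cast
      rw [ZMod.natCast_zmod_val]
    · obtain ⟨s, hs, hsm, hx⟩ := corner_transverse_le₂ y μ ν hu hRt hi (by omega)
      rw [if_neg (fun h => hui h.2), coarsen_apply_of_eq_cast hk _ i hsm hx, ZMod.natCast_zmod_val]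
  · obtain ⟨s, hs, hsm, hx⟩ := corner_longitudinal₂ y μ ν hu hi
    rw [if_neg (fun h => hi h.1), coarsen_apply_of_eq_cast hk _ i hsm hx, ZMod.natCast_zmod_val]

/-- The cell when `u_μ ≤ 0`. [cite: Balaban1987RG1, (0.3) p.252] -/
theorem coarsen_boxSite_cornerSite_of_le₂ (hμ : u μ ≤ 0) :
    coarsen k (boxSite (cornerSite k y μ ν) u) = if 1 ≤ u ν then y.shift ν else y := by
  funext i
  rw [coarsen_boxSite_cornerSite_apply₂ hk y μ ν hu hRt i]
  by_cases hν1 : 1 ≤ u ν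
  · rw [if_pos hν1]
    by_cases hiν : i = ν
    · subst hiν
      rw [if_pos ⟨Or.inr rfl, hν1⟩]
      simp [Site.shift]
    · have hc : ¬ ((i = μ ∨ i = ν) ∧ 1 ≤ u i) := by
        rintro ⟨hi | hi, h1⟩
        · rw [hi] at h1; omega
        · exact hiν hi
      rw [if_neg hc]
      simp [Site.shift, Function.update_of_ne hiν]
  · rw [if_neg hν1]
    have hc : ¬ ((i = μ ∨ i = ν) ∧ 1 ≤ u i) := by
      rintro ⟨hi | hi, h1⟩
      · rw [hi] at h1; omega
      · rw [hi] at h1; omega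
    rw [if_neg hc]

/-- The cell when `u_ν ≤ 0`. [cite: Balaban1987RG1, (0.3) p.252] -/
theorem coarsen_boxSite_cornerSite_of_le₂' (hν : u ν ≤ 0) :
    coarsen k (boxSite (cornerSite k y μ ν) u) = if 1 ≤ u μ then y.shift μ else y := by
  funext i
  rw [coarsen_boxSite_cornerSite_apply₂ hk y μ ν hu hRt i]
  by_cases hμ1 : 1 ≤ u μ
  · rw [if_pos hμ1]
    by_cases hiμ : i = μ
    · subst hiμ
      rw [if_pos ⟨Or.inl rfl, hμ1⟩]
      simp [Site.shift]
    · have hc : ¬ ((i = μ ∨ i = ν) ∧ 1 ≤ u i) := by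
        rintro ⟨hi | hi, h1⟩
        · exact hiμ hi
        · rw [hi] at h1; omega
      rw [if_neg hc]
      simp [Site.shift, Function.update_of_ne hiμ]
  · rw [if_neg hμ1]
    have hc : ¬ ((i = μ ∨ i = ν) ∧ 1 ≤ u i) := by
      rintro ⟨hi | hi, h1⟩
      · rw [hi] at h1; omega
      · rw [hi] at h1; omega
    rw [if_neg hc]

/-- **★ THE SECTION ON THE TUBE BOX IS THE MODEL SECTION** (both endpoints of the bond in the box, so the exiting longitudinal bond of the top slice is excluded):
`pullB (cornerSite k y μ ν) (iterSec k V) u κ = modelSec μ ν V(y,μ) V(y+e_μ,ν) V(y+e_ν,μ) V(y,ν) u κ`. [cite: Balaban1985Variational, (11) p.279] -/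
theorem pullB_iterSec_eq_modelSec₂ {n : Type*} [Fintype n] [DecidableEq n] [Nonempty n] (hμν : μ ≠ ν)
    (V : GaugeField P k (Matrix.specialUnitaryGroup n ℂ)) (κ : Fin P.d) (hu' : InTube μ ν Rt (P.L ^ k / 2) (u + e κ)) :
    pullB (cornerSite k y μ ν) (iterSec k V) u κ =
      modelSec μ ν (V ⟨y, μ⟩) (V ⟨y.shift μ, ν⟩) (V ⟨y.shift ν, μ⟩) (V ⟨y, ν⟩) u κ := by
  rw [pullB_apply, iterSec_apply k hk]
  have hlast := isLast_boxSite_cornerSite_iff₂ hk y μ ν hu hRt κ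
  by_cases hκμ : κ = μ
  · subst hκμ
    rw [modelSec_μ κ ν _ _ _ _ hμν]
    by_cases h0 : u κ = 0
    · rw [if_pos (hlast.mpr (Or.inl ⟨Or.inl rfl, h0⟩)), if_pos h0, coarsen_boxSite_cornerSite_of_le₂ hk y κ ν hu hRt (by omega)]
      by_cases hν : u ν ≤ 0
      · rw [if_neg (by omega), if_pos hν]
      · rw [if_pos (by omega), if_neg hν]
    · have hnot : ¬ ((boxSite (cornerSite k y κ ν) u κ).val % P.L ^ k = P.L ^ k - 1) := fun h => by
        rcases hlast.mp h with ⟨-, h'⟩ | ⟨h', -⟩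
        · exact h0 h'
        · exact h' (Or.inl rfl)
      rw [if_neg hnot, if_neg h0]
  · by_cases hκν : κ = ν
    · subst hκν
      rw [modelSec_ν μ κ _ _ _ _ hμν]
      by_cases h0 : u κ = 0
      · rw [if_pos (hlast.mpr (Or.inl ⟨Or.inr rfl, h0⟩)), if_pos h0, coarsen_boxSite_cornerSite_of_le₂' hk y μ κ hu hRt (by omega)]
        by_cases hμ : u μ ≤ 0
        · rw [if_neg (by omega), if_pos hμ]
        · rw [if_pos (by omega), if_neg hμ]
      · have hnot : ¬ ((boxSite (cornerSite k y μ κ) u κ).val % P.L ^ k = P.L ^ k - 1) := fun h => by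
          rcases hlast.mp h with ⟨-, h'⟩ | ⟨h', -⟩
          · exact h0 h'
          · exact h' (Or.inr rfl)
        rw [if_neg hnot, if_neg h0]
    · -- longitudinal bond: both endpoints in the box ⇒ `u_κ + 1 ≤ ⌊L^k/2⌋`, so `u_κ` is not the top slice
      have hκ' : ¬ (κ = μ ∨ κ = ν) := fun h => h.elim hκμ hκν
      have htop : u κ ≠ (P.L ^ k / 2 : ℕ) := by
        have := abs_le.mp (hu'.abs_le_of_not_mem hκ')
        rw [add_e_apply_same] at this
        omega
      have hnot : ¬ ((boxSite (cornerSite k y μ ν) u κ).val % P.L ^ k = P.L ^ k - 1) := fun h => by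
        rcases hlast.mp h with ⟨h', -⟩ | ⟨-, h'⟩
        · exact hκ' h'
        · exact htop h'
      rw [modelSec_of_ne μ ν _ _ _ _ hκμ hκν, if_neg hnot]

end TwoRadii

/-! ## §2 The graft of a model field along the tube box -/

section Graft

variable {P : Params} {G : Type*}

/-- **A TUBE BOND**: a fine bond whose two endpoints are chart points of the tube box at the corner `c`. [folklore] -/
def TubeBond (c : Site P 0) (μ ν : Fin P.d) (Rt hl : ℕ) (b : PBond P 0) : Prop :=
  ∃ u : Fin P.d → ℤ, InTube μ ν Rt hl u ∧ InTube μ ν Rt hl (u + e b.dir) ∧ boxSite c u = b.src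

open Classical in
/-- **THE GRAFT**: the model field `M` (read through the chart at `c`) on the tube bonds, the background `W` on every other bond. [cite: Balaban1985Variational, (11) p.279] -/
def graft (c : Site P 0) (μ ν : Fin P.d) (Rt hl : ℕ) (M : (Fin P.d → ℤ) → Fin P.d → G) (W : GaugeField P 0 G) : GaugeField P 0 G :=
  fun b => if h : TubeBond c μ ν Rt hl b then M (Classical.choose h) b.dir else W b

variable (c : Site P 0) (μ ν : Fin P.d) {Rt hl : ℕ} (hN : 2 * max Rt hl + 1 ≤ P.sitesPerDir 0) (M : (Fin P.d → ℤ) → Fin P.d → G) (W : GaugeField P 0 G)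
include hN

/-- **THE GRAFT ON A TUBE BOND READS THE MODEL FIELD** (the chart is injective on the box: `2·max(Rt, hl) + 1 ≤ N₀`). [folklore] -/
theorem graft_apply_boxSite {u : Fin P.d → ℤ} {κ : Fin P.d} (hu : InTube μ ν Rt hl u) (hu' : InTube μ ν Rt hl (u + e κ)) :
    graft c μ ν Rt hl M W ⟨boxSite c u, κ⟩ = M u κ := by
  classical
  have h : TubeBond c μ ν Rt hl ⟨boxSite c u, κ⟩ := ⟨u, hu, hu', rfl⟩
  unfold graft
  rw [dif_pos h]
  have hspec := Classical.choose_spec h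
  have heq : Classical.choose h = u := boxSite_injOn c hN hspec.1.inBox hu.inBox hspec.2.2
  rw [heq]

omit hN in
/-- Off the tube bonds the graft is the background. [folklore] -/
theorem graft_apply_of_not {b : PBond P 0} (h : ¬ TubeBond c μ ν Rt hl b) : graft c μ ν Rt hl M W b = W b := by
  classical
  unfold graft
  rw [dif_neg h]

omit hN in
/-- If the model field agrees with the background (read through the chart) on every tube bond, the graft IS the background. [folklore] -/
theorem graft_eq_of_agree (hMW : ∀ u κ, InTube μ ν Rt hl u → InTube μ ν Rt hl (u + e κ) → M u κ = pullB c W u κ) (b : PBond P 0) :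
    graft c μ ν Rt hl M W b = W b := by
  classical
  unfold graft
  split_ifs with h
  · obtain ⟨hu, hu', hsrc⟩ := Classical.choose_spec h
    rw [hMW _ _ hu hu', pullB_apply]
    cases b
    simp only at hsrc
    rw [hsrc]
  · rfl

/-- **★★ PLAQUETTES OF THE GRAFT INSIDE THE BOX ARE THE MODEL PLAQUETTES**: if the four corners `u, u+e_α, u+e_β, u+e_α+e_β` lie in the tube box then
`(graft …)(∂⟨c+u; α, β⟩) = plaqB M u α β`. [cite: Balaban1985Averaging, (9) p.19] -/
theorem plaqHol_graft_boxSite [GaugeGroup G] {u : Fin P.d → ℤ} {α β : Fin P.d} (hαβ : α < β)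
    (h00 : InTube μ ν Rt hl u) (h10 : InTube μ ν Rt hl (u + e α)) (h01 : InTube μ ν Rt hl (u + e β)) (h11 : InTube μ ν Rt hl (u + e α + e β)) :
    GaugeField.plaqHol (graft c μ ν Rt hl M W) ⟨boxSite c u, α, β, hαβ⟩ = plaqB M u α β := by
  have h11' : InTube μ ν Rt hl (u + e β + e α) := by rw [add_e_comm u β α]; exact h11
  simp only [GaugeField.plaqHol, plaqB, ← boxSite_add_e]
  rw [graft_apply_boxSite c μ ν hN M W h00 h10, graft_apply_boxSite c μ ν hN M W h10 h11,
    graft_apply_boxSite c μ ν hN M W h01 h11', graft_apply_boxSite c μ ν hN M W h00 h01]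

end Graft

/-! ## §3 The tube graft along an interior edge: exact plaquettes, agreement with the section -/

section Tube

variable {P : Params} {n : Type*} [Fintype n] [DecidableEq n] [Nonempty n]
variable {k : ℕ} (hk : k ≤ P.m + P.K) (y : Site P k) {μ ν : Fin P.d} (hμν : μ ≠ ν) {Rt : ℕ} (hRt : Rt + 2 ≤ P.L ^ k)
  (hN : 2 * max Rt (P.L ^ k / 2) + 1 ≤ P.sitesPerDir 0)
  (V : GaugeField P k (Matrix.specialUnitaryGroup n ℂ)) (F' : lieSU n)
  (hF : expSU F' = V ⟨y, ν⟩ * V ⟨y.shift ν, μ⟩ * (V ⟨y.shift μ, ν⟩)⁻¹ * (V ⟨y, μ⟩)⁻¹)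
  (t : (Fin P.d → ℤ) → Fin P.d → ℝ)
include hk hμν hRt hN hF

omit hk hμν hRt hF in
/-- **★★ THE TUBE'S PLAQUETTES INSIDE THE BOX, EXACTLY**: `G(u)⁻¹·expSU((curlB t)(u;α,β)·F′)·G(u)`. [cite: Balaban1985Averaging, (9)+(12) p.19; Rossmann2002, §1.1] -/
theorem plaqHol_graft_tubeU {u : Fin P.d → ℤ} {α β : Fin P.d} (hαβ : α < β)
    (h00 : InTube μ ν Rt (P.L ^ k / 2) u) (h10 : InTube μ ν Rt (P.L ^ k / 2) (u + e α)) (h01 : InTube μ ν Rt (P.L ^ k / 2) (u + e β))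
    (h11 : InTube μ ν Rt (P.L ^ k / 2) (u + e α + e β)) :
    GaugeField.plaqHol (graft (cornerSite k y μ ν) μ ν Rt (P.L ^ k / 2) (tubeU μ ν (V ⟨y, μ⟩) (V ⟨y.shift μ, ν⟩) (V ⟨y, ν⟩) F' t) (iterSec k V))
        ⟨boxSite (cornerSite k y μ ν) u, α, β, hαβ⟩ =
      (quadG μ ν (V ⟨y, μ⟩) (V ⟨y.shift μ, ν⟩) (V ⟨y, ν⟩) u)⁻¹ * expSU (curlB t u α β • F') * quadG μ ν (V ⟨y, μ⟩) (V ⟨y.shift μ, ν⟩) (V ⟨y, ν⟩) u := by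
  rw [plaqHol_graft_boxSite _ μ ν hN _ _ hαβ h00 h10 h01 h11, plaqB_tubeU]

omit hk hμν hRt hF in
/-- **★ HENCE `dist1 ≤ e^{|curlB t|·‖F′‖} − 1` inside the box.** [cite: Balaban1985Averaging, (12) p.19, (19) p.21] -/
theorem dist1_plaqHol_graft_tubeU_le {u : Fin P.d → ℤ} {α β : Fin P.d} (hαβ : α < β)
    (h00 : InTube μ ν Rt (P.L ^ k / 2) u) (h10 : InTube μ ν Rt (P.L ^ k / 2) (u + e α)) (h01 : InTube μ ν Rt (P.L ^ k / 2) (u + e β))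
    (h11 : InTube μ ν Rt (P.L ^ k / 2) (u + e α + e β)) :
    GaugeGroup.dist1 (GaugeField.plaqHol (graft (cornerSite k y μ ν) μ ν Rt (P.L ^ k / 2) (tubeU μ ν (V ⟨y, μ⟩) (V ⟨y.shift μ, ν⟩) (V ⟨y, ν⟩) F' t) (iterSec k V))
        ⟨boxSite (cornerSite k y μ ν) u, α, β, hαβ⟩) ≤ Real.exp (|curlB t u α β| * ‖(F' : Matrix n n ℂ)‖) - 1 := by
  rw [plaqHol_graft_boxSite _ μ ν hN _ _ hαβ h00 h10 h01 h11]
  exact dist1_plaqB_tubeU_le μ ν _ _ _ F' t u α β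

omit hk hμν hRt hF in
/-- Plaquettes inside the box with vanishing `curlB t` are trivial (longitudinal plaquettes; transverse plaquettes off the density). [cite: Balaban1985Averaging, (12) p.19] -/
theorem plaqHol_graft_tubeU_eq_one {u : Fin P.d → ℤ} {α β : Fin P.d} (hαβ : α < β)
    (h00 : InTube μ ν Rt (P.L ^ k / 2) u) (h10 : InTube μ ν Rt (P.L ^ k / 2) (u + e α)) (h01 : InTube μ ν Rt (P.L ^ k / 2) (u + e β))
    (h11 : InTube μ ν Rt (P.L ^ k / 2) (u + e α + e β)) (h0 : curlB t u α β = 0) :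
    GaugeField.plaqHol (graft (cornerSite k y μ ν) μ ν Rt (P.L ^ k / 2) (tubeU μ ν (V ⟨y, μ⟩) (V ⟨y.shift μ, ν⟩) (V ⟨y, ν⟩) F' t) (iterSec k V))
        ⟨boxSite (cornerSite k y μ ν) u, α, β, hαβ⟩ = 1 := by
  rw [plaqHol_graft_boxSite _ μ ν hN _ _ hαβ h00 h10 h01 h11]
  exact plaqB_tubeU_eq_one μ ν _ _ _ F' t u α β h0

/-- **OFF THE PROFILE THE GRAFT IS THE SECTION**: on a tube bond where `t` agrees with the string indicator the grafted value IS the section's value.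
[cite: Balaban1985Variational, (11) p.279] -/
theorem graft_tubeU_apply_eq_iterSec {u : Fin P.d → ℤ} {κ : Fin P.d} (hu : InTube μ ν Rt (P.L ^ k / 2) u) (hu' : InTube μ ν Rt (P.L ^ k / 2) (u + e κ))
    (ht : t u κ = stringInd μ ν u κ) :
    graft (cornerSite k y μ ν) μ ν Rt (P.L ^ k / 2) (tubeU μ ν (V ⟨y, μ⟩) (V ⟨y.shift μ, ν⟩) (V ⟨y, ν⟩) F' t) (iterSec k V) ⟨boxSite (cornerSite k y μ ν) u, κ⟩ =
      iterSec k V ⟨boxSite (cornerSite k y μ ν) u, κ⟩ := by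
  rw [graft_apply_boxSite _ μ ν hN _ _ hu hu', tubeU_eq_modelSec_of_eq μ ν _ _ (V ⟨y.shift ν, μ⟩) _ F' hμν hF ht,
    ← pullB_iterSec_eq_modelSec₂ hk y μ ν hu hRt hμν V κ hu', pullB_apply]

/-- **HENCE THE GRAFT IS THE SECTION EXCEPT WHERE `t ≠ s`**: if `t` and the string indicator agree on every tube bond outside a set `Z` of chart points, the graft and the section
agree on every fine bond that is not a tube bond charted in `Z`. [cite: Balaban1985Variational, (11) p.279] -/
theorem graft_tubeU_eq_iterSec_of_not_mem (Z : Set (Fin P.d → ℤ))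
    (ht : ∀ u κ, InTube μ ν Rt (P.L ^ k / 2) u → InTube μ ν Rt (P.L ^ k / 2) (u + e κ) → u ∉ Z → t u κ = stringInd μ ν u κ)
    (b : PBond P 0) (hb : ∀ u, InTube μ ν Rt (P.L ^ k / 2) u → InTube μ ν Rt (P.L ^ k / 2) (u + e b.dir) → boxSite (cornerSite k y μ ν) u = b.src → u ∉ Z) :
    graft (cornerSite k y μ ν) μ ν Rt (P.L ^ k / 2) (tubeU μ ν (V ⟨y, μ⟩) (V ⟨y.shift μ, ν⟩) (V ⟨y, ν⟩) F' t) (iterSec k V) b = iterSec k V b := by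
  classical
  by_cases h : TubeBond (cornerSite k y μ ν) μ ν Rt (P.L ^ k / 2) b
  · obtain ⟨u, hu, hu', hsrc⟩ := h
    cases b with
    | mk src dir =>
      simp only at hsrc hu' hb
      subst hsrc
      exact graft_tubeU_apply_eq_iterSec hk y hμν hRt hN V F' hF t hu hu' (ht u dir hu hu' (hb u hu hu' rfl))
  · exact graft_apply_of_not _ μ ν _ _ h

end Tube


end Summit.QuantumFields.YangMills.Theorems.TubeStart

end
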